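import Summits.CriticalPhenomena.Ising3DConformalLimit.Theses.EnergyNotSigmaSquared
import Literature.Probability.LatticeModels.CurrentsSetConditioning
import Literature.Probability.LatticeModels.CurrentExplorationWeights

/-!
# Sketch — crux-ideate stmt-CriticalPhenomena-4468 (GapForcesFarMerging), ideator 3, round 1

First-lemma signatures of the three idea cards (they only need to ELABORATE; nothing is proved here):
* card `one-cluster-depletion-sandwich`: `TwoEndedAsDepletion` (Lemma A.1 instance) and `SandwichLower`;
* card `gap-forces-top-heavy-scales`: `TopHeavyIO`, `GapForcesTopHeavy`, `TopHeavyForcesFarMerging`,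
  the composition `crux_of_topHeavy_split`, and the support `TwoPointDensityLower`;
* card `rp-gram-halving`: `PairGramPSD` (the RP input), `OneEndedHalving` (first lemma), `OneEndedGap`.
-/

open scoped BigOperators symmDiff ENNReal
open Literature.Probability.LatticeModels Finset

namespace Summit.CriticalPhenomena.Ising3DConformalLimit.Cruxes.GapForcesFarMerging.Sketch

/-! ## Common lattice vocabulary -/

/-- `e i` = the `i`-th unit vector of `ℤ³`. -/
abbrev e (i : Fin 3) : Site 3 := Pi.single i 1

/-- The critical two-point function `G(x) = ⟨σ₀σ_x⟩_{β_c(3)}`. -/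
noncomputable abbrev G (x : Site 3) : ℝ := criticalTwoPoint 3 x

/-- Truncated pair–pair correlation `⟨σ_aσ_b ; σ_cσ_d⟩_{β_c(3)}`. -/
noncomputable def pairCov (a b c d : Site 3) : ℝ :=
  criticalCorr 3 4 ![a, b, c, d] - criticalCorr 3 2 ![a, b] * criticalCorr 3 2 ![c, d]

/-- The far-merging conclusion of the crux, verbatim (consequent of `GapForcesFarMerging`). -/
def FarMerging : Prop :=
  ∃ c : ℝ, 0 < c ∧ ∃ x : Fin 4 → Site 3, Function.Injective x ∧ ∀ L₀ : ℕ, ∃ L : ℕ, L₀ ≤ L ∧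
    criticalCorr 3 4 (fun i => (L : ℤ) • x i) -
      (criticalCorr 3 2 ![(L : ℤ) • x 0, (L : ℤ) • x 1] * criticalCorr 3 2 ![(L : ℤ) • x 2, (L : ℤ) • x 3] +
       criticalCorr 3 2 ![(L : ℤ) • x 0, (L : ℤ) • x 2] * criticalCorr 3 2 ![(L : ℤ) • x 1, (L : ℤ) • x 3] +
       criticalCorr 3 2 ![(L : ℤ) • x 0, (L : ℤ) • x 3] * criticalCorr 3 2 ![(L : ℤ) • x 1, (L : ℤ) • x 2])
      ≤ -(c * (criticalCorr 3 2 ![(L : ℤ) • x 0, (L : ℤ) • x 1] * criticalCorr 3 2 ![(L : ℤ) • x 2, (L : ℤ) • x 3]))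

/-- The crux is literally `EnergyGapPowerLaw → FarMerging`. -/
theorem crux_iff : Theses.EnergyNotSigmaSquared.GapForcesFarMerging ↔
    (Theses.EnergyNotSigmaSquared.EnergyGapPowerLaw → FarMerging) := Iff.rfl

/-! ## Card `one-cluster-depletion-sandwich` — finite-graph statements (current-sum form, couplings `K ≥ 0`) -/

section Finite

variable {V : Type} [Fintype V] [DecidableEq V] (Γ : SimpleGraph V) [DecidableRel Γ.Adj]

/-- **Two-ended avoidance is an expected depletion ratio (Lemma A.1 instance).** For sources
`{o,x}` and `{a,x'}`: `∑ 1{∂n₁={o,x}} 1{∂n₃={a,x'}} w w 𝟙[a ∉ C_{n₁+n₃}(o)]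
 = ∑ 1{∂n₁={o,x}} 1{∂n₂=∅} w w 𝟙[a,x' ∉ C] · Z_{Γ∖C}[{a,x'}]/Z_{Γ∖C}[∅]`, `C = C_{n₁+n₂}(o)` —
`A · G(a,x') = E^{ox,∅}[𝟙[a,x'∉C] G_{Λ∖C}(a,x')]`. (Instance of
`Current.tsum_epairWeight_eq_tsum_mul_offRatio_set`; provable now.) -/
def TwoEndedAsDepletion : Prop :=
  ∀ (K : Γ.edgeFinset → ℝ), (∀ ed, 0 ≤ K ed) → ∀ o x a x' : V,
    (∑' p : Current Γ × Current Γ, epairWeight K ({o} ∆ {x}) ({a} ∆ {x'}) p *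
        (if a ∉ (p.1 + p.2).cluster o then 1 else 0)) =
    ∑' p : Current Γ × Current Γ, epairWeight K ({o} ∆ {x}) ∅ p *
        ((if a ∉ (p.1 + p.2).cluster o ∧ x' ∉ (p.1 + p.2).cluster o then 1 else 0) *
          Current.offRatio K ((p.1 + p.2).cluster o) ({a} ∆ {x'}))

/-- **Sandwich, lower half.** Backbone-weight domain monotonicity (`ρ_{Λ∖C}(ω) ≥ ρ_Λ(ω)`, from the
super-multiplicativity `Current.ecurrentSum_koff_union_mul_ge`) turns the depletion ratio into an
avoidance probability of an INDEPENDENT explored backbone: `Z[∅] · ∑_{(n₁,n₂),n₃} 1{∂n₁={o,x}}1{∂n₂=∅}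
1{∂n₃={a,x'}} w w w 𝟙[vis(explore n₃ from a to x') ∩ C_{n₁+n₂}(o) = ∅ ∧ x' ∉ C] ≤ Z[∅]·(lhs of
TwoEndedAsDepletion)·…`, i.e. `A ≥ P^{ox,∅} ⊗ P^{ax'}[explored backbone of n₃ misses C_{n₁+n₂}(o)]`. -/
def SandwichLower : Prop :=
  ∀ (K : Γ.edgeFinset → ℝ) (rk : Γ.edgeFinset → ℕ), (∀ ed, 0 ≤ K ed) → Function.Injective rk →
    ∀ o x a x' : V,
    (∑' q : (Current Γ × Current Γ) × Current Γ,
        epairWeight K ({o} ∆ {x}) ∅ q.1 *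
        ((if q.2.sources = {a} ∆ {x'} then q.2.eweight K else 0) *
          (if Disjoint (insert x' (Current.explore rk q.2 {x'} a).tch) ((q.1.1 + q.1.2).cluster o)
            then 1 else 0)))
      ≤ ecurrentSum K ∅ *
        ∑' p : Current Γ × Current Γ, epairWeight K ({o} ∆ {x}) ({a} ∆ {x'}) p *
          (if a ∉ (p.1 + p.2).cluster o then 1 else 0)

/-- **Support (card `gap-forces-top-heavy-scales`): the duplicated cluster's two-point density is known
up to a factor 2.** Lower half, from the switching ("teleport") identity and Remark A.5:
`Z[{o,u}]·Z[{u,v}]·Z[{v,x}] ≤ Z[∅] · ∑ 1{∂n₁={o,x}}1{∂n₂=∅} w w 𝟙[u, v ∈ C_{n₁+n₂}(o)]`, i.e.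
`P^{ox,∅}[u,v ∈ C(o)] ≥ G(ou)G(uv)G(vx)/G(ox)`; the upper half is Prop. A.3 (in tree). Provable now. -/
def TwoPointDensityLower : Prop :=
  ∀ (K : Γ.edgeFinset → ℝ), (∀ ed, 0 ≤ K ed) → ∀ o x u v : V,
    ecurrentSum K ({o} ∆ {u}) * ecurrentSum K ({u} ∆ {v}) * ecurrentSum K ({v} ∆ {x}) ≤
      ecurrentSum K ∅ *
        ∑' p : Current Γ × Current Γ, epairWeight K ({o} ∆ {x}) ∅ p *
          (if u ∈ (p.1 + p.2).cluster o ∧ v ∈ (p.1 + p.2).cluster o then 1 else 0)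

end Finite

/-! ## Card `gap-forces-top-heavy-scales` -/

/-- Dyadic bubble mass `b_k = Σ_{x ∈ Λ_{2^{k+1}} ∖ Λ_{2^k}} G(x)²` and partial bubble `B_k = Σ_{x ∈ Λ_{2^{k+1}}} G(x)²`. -/
noncomputable def shellMass (k : ℕ) : ℝ := ∑ x ∈ box 3 (2 ^ (k + 1)) \ box 3 (2 ^ k), G x ^ 2
noncomputable def bubbleTo (k : ℕ) : ℝ := ∑ x ∈ box 3 (2 ^ (k + 1)), G x ^ 2

/-- **Top-heaviness along a positive density of dyadic scales**: `b_k ≥ τ · B_k` for at least a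
fraction `θ` of the scales `k ≤ K`, for all large `K`. -/
def TopHeavyIO : Prop :=
  ∃ τ θ : ℝ, 0 < τ ∧ 0 < θ ∧ ∀ᶠ K : ℕ in Filter.atTop,
    θ * K ≤ (((Finset.range K).filter fun k => τ * bubbleTo k ≤ shellMass k).card : ℝ)

/-- K1 of the card (hazard telescoping): the two-ended power gap forces top-heavy scales. -/
def GapForcesTopHeavy : Prop := Theses.EnergyNotSigmaSquared.EnergyGapPowerLaw → TopHeavyIO

/-- K2 of the card (single-scale second moment + SingleDouble, the top-heavy card's engine). -/
def TopHeavyForcesFarMerging : Prop := TopHeavyIO → FarMerging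

/-- The split closes the crux by composition. -/
theorem crux_of_topHeavy_split (h₁ : GapForcesTopHeavy) (h₂ : TopHeavyForcesFarMerging) :
    Theses.EnergyNotSigmaSquared.GapForcesFarMerging := fun hgap => h₂ (h₁ hgap)

/-! ## Card `rp-gram-halving` -/

/-- **RP input (Gram positivity of pair observables across the plane `x₀ = t/2`, even `t`).** For pair
observables `σ_vσ_w` in the time-zero plane and their reflections at time `t`, the truncated matrix
`[⟨σ_vσ_w ; σ_{θv'}σ_{θw'}⟩]` is positive semidefinite; recorded as its `2 × 2` minors, which is all the
card uses. (`θ z = z + t e₀` for `z` in the plane `z 0 = 0`.) -/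
def PairGramPSD : Prop :=
  ∀ (t : ℕ) (v w v' w' : Site 3), Even t → v 0 = 0 → w 0 = 0 → v' 0 = 0 → w' 0 = 0 →
    pairCov v w (v' + (t : ℤ) • e 0) (w' + (t : ℤ) • e 0) ^ 2 ≤
      pairCov v w (v + (t : ℤ) • e 0) (w + (t : ℤ) • e 0) *
        pairCov v' w' (v' + (t : ℤ) • e 0) (w' + (t : ℤ) • e 0)

/-- **First lemma of the card (halving, dipole row).** With `ε₀ = σ₀σ_{e₁}` and a pair `(y, y')` in
the time-zero plane: `⟨ε₀ ; σ_{te₀+y}σ_{te₀+y'}⟩² ≤ ⟨ε₀ ; ε_{te₀}⟩ · ⟨σ_yσ_{y'} ; σ_{te₀+y}σ_{te₀+y'}⟩`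
(the `2×2` minor of `PairGramPSD` with rows `(0,e₁)` and `(y,y')`). -/
def OneEndedHalving : Prop :=
  ∀ (t : ℕ) (y y' : Site 3), Even t → y 0 = 0 → y' 0 = 0 →
    pairCov 0 (e 1) (y + (t : ℤ) • e 0) (y' + (t : ℤ) • e 0) ^ 2 ≤
      pairCov 0 (e 1) ((t : ℤ) • e 0) (e 1 + (t : ℤ) • e 0) *
        pairCov y y' (y + (t : ℤ) • e 0) (y' + (t : ℤ) • e 0)

theorem oneEndedHalving_of_pairGramPSD (h : PairGramPSD) : OneEndedHalving := by
  intro t y y' ht hy hy'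
  have := h t 0 (e 1) y y' ht rfl (by simp [e]) hy hy'
  simpa using this

/-- **One-ended power gap (the output of GAP + halving + Lebowitz + MMS)**: for even `t` and plane
offsets `y, y'` with `‖y‖, ‖y'‖ ≤ t`, `⟨ε₀ ; σ_{te₀+y}σ_{te₀+y'}⟩ ≤ C t^{-κ/2} G(te₀)²`
(so the Ursell function is saturated, up to `t^{-κ/2}·D(t)`, at every configuration with ONE adjacent pair). -/
def OneEndedGap : Prop :=
  ∃ κ C : ℝ, 0 < κ ∧ ∀ (t : ℕ) (y y' : Site 3), Even t → 0 < t → y 0 = 0 → y' 0 = 0 →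
    ‖y‖ ≤ t → ‖y'‖ ≤ t →
    pairCov 0 (e 1) (y + (t : ℤ) • e 0) (y' + (t : ℤ) • e 0) ≤
      C * (t : ℝ) ^ (-κ / 2) * G ((t : ℤ) • e 0) ^ 2

/-- Transfer statement of the card: the one-ended gap already forces far merging. -/
def OneEndedGapForcesFarMerging : Prop := OneEndedGap → FarMerging

end Summit.CriticalPhenomena.Ising3DConformalLimit.Cruxes.GapForcesFarMerging.Sketch
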